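import Mathlib
import Summits.NavierStokesRegularity.NavierStokesRegularity.Theorems.EulerZoomLiouvillePowerGaugeEulerLiouvilleSelfSimilarBernoulliSqueeze
import Summits.NavierStokesRegularity.NavierStokesRegularity.Theorems.EulerZoomLiouvillePowerGaugeEulerLiouvilleSelfSimilarBernoulliBounded
import Summits.NavierStokesRegularity.NavierStokesRegularity.Theorems.EulerZoomLiouvillePowerGaugeEulerLiouvilleSelfSimilarBernoulliThinness
import HarnessLib

/-!
# «SUPER-FAST CHANNELS SQUEEZE VOLUME TOO FAST», member level: an exactly self-similar member of the power-gauged class whose `C²`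
# profile has linear growth, an UNPRESSURISED far field and a SUPER-FAST far channel is trivial
# (crux `EulerZoomLiouville.PowerGaugeEulerLiouville` = stmt-NavierStokesRegularity-19832, line `birth`, THE ONE STATEMENT)

Route №10 `EulerZoomLiouville` (NavierStokesRegularity); width seat ns-ezl-w5 g0.  Sequel of `…SelfSimilarBernoulliSqueeze`
(`Loc.curl_eq_zero_of_fastChannel_of_thin`: the (C2) volume-squeeze with an abstract thinness rate `m`).  Here the thinness is DISCHARGED from the
`A`-gauge alone, in the UNPRESSURISED model class of the LEAD's RESIDUE-MEMO-19832-g11 §2 (C2):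

* `volume_fastSet_inter_shell_le` / `volume_fastSet_inter_far_le` — **the FAST SET is thin**: for a profile with `∫_{B_L}|V|² ≤ c L^{1−2ρ}` (all
  `L > 0`) and any `a > 0`, `vol({‖V y‖ ≥ a‖y‖} ∩ {L ≤ ‖y‖ ≤ 2L}) ≤ C′ L^{−1−2ρ}` (Chebyshev) and `vol({‖V y‖ ≥ a‖y‖} ∩ {‖y‖ ≥ R}) ≤ C″ R^{−1−2ρ}`
  (dyadic shells, sz-p1's `BernoulliThinness.tsum_ofReal_mul_two_pow_mul_rpow_le`) — no pressure at all;
* `bernoulliHigh_subset_fastSet_of_pressure_le` — **an unpressurised high set is fast**: if `P(y) ≤ ε‖y‖²` for `‖y‖ ≥ R₁` with `ε ≤ γ(1−2γ)/4`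
  (`0 < γ < ½`), then far out `{ℋ > h} ⊆ {‖V y‖ ≥ a_γ‖y‖}`, `a_γ = (√(γ/2) − γ)/2 > 0` (`ℋ = ½|γy+V|² + P + ½γ(γ−1)|y|²`, so `|γy+V|² > (γ/2)|y|² + 2h`);
* **`Loc.selfSimilar_ae_eq_zero_of_fastChannelC2_profile`** — MEMBER LEVEL, crux hypotheses verbatim (`0 < ρ ≤ ½`) + exact self-similarity +
  `V ∈ C²` of linear growth `‖V y‖ ≤ K₁(1+‖y‖)` + for every classical pressure `P′` of `V`: an unpressurised far field (`P′ ≤ ε‖y‖²` far out,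
  `ε ≤ γ(1−2γ)/4`, `γ = 1/(2+ρ)`) and a far FAST CHANNEL on every high set (`⟪y, γy + V y⟫ ≤ −c₁‖y‖²` for `‖y‖ ≥ R₀(h)`, `ℋ_{P′}(y) > h`) of
  SUPER-FAST rate `c₁ > 3/((2+ρ)(1+2ρ))` ⇒ `u = 0` a.e. on `(−∞,0) × ℝ³` (thinness rate `m = 1+2ρ`; race `c₁(1+2ρ) > 3γ`; then the LEAD's
  `Loc.selfSimilar_ae_eq_zero_of_irrotationalC2_profile`).

HONEST LABEL: PARTIAL model-class stratum — super-fast far channels only (`s − γ ≥ c₁ > 3/((2+ρ)(1+2ρ)) ∈ [0.6, 1.5)`), linear-growth profiles; the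
marginal channels of THE ONE STATEMENT (`s − γ` small, pressurised or Bernoulli-unbounded) are untouched; a super-polynomial thinness input would
remove the rate threshold via the same squeeze theorem.

WHAT THIS IS NOT: not NS, not E — a classical sub-stratum `--supports` stmt-19832 on the MODEL lattice (E/NS strata); 19832 OPEN; NS regularity NOT
proved. [folklore; ConstantinIgnatovaVicol2026Putative §3.4.1, §3.4.3 (3.30)]
-/

noncomputable section

-- flat `Theorems/<Route><Decl>…` files of one crux share the namespace of the crux (tree convention)
set_option linter.dupNamespace false

open MeasureTheory Set Filter Topology Metric Function InnerProductSpace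
open scoped RealInnerProductSpace NNReal ENNReal ContDiff

namespace Summit.NavierStokesRegularity.NavierStokesRegularity.Theorems.PowerGaugeEulerLiouville.Loc

open Literature.Analysis Literature.Analysis.FluidPDE Literature.Analysis.FunctionSpaces
open Summit.NavierStokesRegularity.NavierStokesRegularity.Theorems.PowerGaugeEulerLiouville.BernoulliThinness

/-! ### The fast set is thin (`A`-gauge only) -/

/-- **Chebyshev on a dyadic shell**: `∫_{B_L}|V|² ≤ c L^{1−2ρ}` for all `L > 0` and `a > 0` give
`vol({‖V y‖ ≥ a‖y‖} ∩ {L ≤ ‖y‖ ≤ 2L}) ≤ (c 3^{1−2ρ}/a²) L^{−1−2ρ}` for `L > 0`. [folklore] -/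
theorem volume_fastSet_inter_shell_le {ρ : ℝ}
    {V : EuclideanSpace ℝ (Fin 3) → EuclideanSpace ℝ (Fin 3)} (hVm : AEStronglyMeasurable V volume) {c : ℝ≥0}
    (hA : ∀ L : ℝ, 0 < L → ∫⁻ y in ball (0 : EuclideanSpace ℝ (Fin 3)) L, ‖V y‖ₑ ^ 2 ≤
      c * ENNReal.ofReal (L ^ (1 - 2 * ρ)))
    {a : ℝ} (ha : 0 < a) {L : ℝ} (hL : 0 < L) :
    volume ({y : EuclideanSpace ℝ (Fin 3) | a * ‖y‖ ≤ ‖V y‖} ∩ {y | L ≤ ‖y‖ ∧ ‖y‖ ≤ 2 * L}) ≤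
      ENNReal.ofReal ((c : ℝ) * (3 : ℝ) ^ (1 - 2 * ρ) / a ^ 2 * L ^ (-1 - 2 * ρ)) := by
  -- adapted from `BernoulliThinness.volume_bernoulliHigh_inter_shell_le` (the `SV` half)
  set g : EuclideanSpace ℝ (Fin 3) → ℝ≥0∞ :=
    (ball (0 : EuclideanSpace ℝ (Fin 3)) (3 * L)).indicator fun y => ‖V y‖ₑ ^ 2 with hg
  have hgm : AEMeasurable g volume := (hVm.aemeasurable.enorm.pow_const _).indicator measurableSet_ball
  have hgint : ∫⁻ y, g y = ∫⁻ y in ball (0 : EuclideanSpace ℝ (Fin 3)) (3 * L), ‖V y‖ₑ ^ 2 := by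
    rw [hg, lintegral_indicator measurableSet_ball]
  set lam : ℝ≥0∞ := ENNReal.ofReal ((a * L) ^ 2) with hlam
  have hlam0 : lam ≠ 0 := (ENNReal.ofReal_pos.2 (by positivity)).ne'
  have hS : ∀ y ∈ {y : EuclideanSpace ℝ (Fin 3) | a * ‖y‖ ≤ ‖V y‖} ∩ {y | L ≤ ‖y‖ ∧ ‖y‖ ≤ 2 * L}, lam ≤ g y := by
    rintro y ⟨hy, hyL, hy2L⟩
    have hyball : y ∈ ball (0 : EuclideanSpace ℝ (Fin 3)) (3 * L) := by
      rw [mem_ball_zero_iff]; linarith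
    rw [hg, indicator_of_mem hyball, hlam, ← ofReal_norm, ← ENNReal.ofReal_pow (norm_nonneg _)]
    refine ENNReal.ofReal_le_ofReal ?_
    have h1 : a * L ≤ ‖V y‖ := (mul_le_mul_of_nonneg_left hyL ha.le).trans hy
    exact pow_le_pow_left₀ (by positivity) h1 2
  calc volume ({y : EuclideanSpace ℝ (Fin 3) | a * ‖y‖ ≤ ‖V y‖} ∩ {y | L ≤ ‖y‖ ∧ ‖y‖ ≤ 2 * L})
      ≤ (∫⁻ y, g y) / lam := measure_le_lintegral_div hgm hlam0 ENNReal.ofReal_ne_top hS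
    _ ≤ (c * ENNReal.ofReal ((3 * L) ^ (1 - 2 * ρ))) / lam := by
        rw [hgint]; exact ENNReal.div_le_div_right (hA (3 * L) (by positivity)) _
    _ = ENNReal.ofReal ((c : ℝ) * (3 : ℝ) ^ (1 - 2 * ρ) / a ^ 2 * L ^ (-1 - 2 * ρ)) := by
        rw [hlam, ← ENNReal.ofReal_coe_nnreal, ← ENNReal.ofReal_mul (NNReal.coe_nonneg _),
          ← ENNReal.ofReal_div_of_pos (by positivity)]
        congr 1
        have e1 : (3 * L) ^ (1 - 2 * ρ) = (3 : ℝ) ^ (1 - 2 * ρ) * L ^ (1 - 2 * ρ) := Real.mul_rpow (by norm_num) hL.le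
        have e2 : L ^ (-1 - 2 * ρ) = L ^ (1 - 2 * ρ) * (L ^ 2)⁻¹ := by
          rw [show (-1 - 2 * ρ) = (1 - 2 * ρ) + (-2 : ℝ) by ring, Real.rpow_add hL, Real.rpow_neg hL.le,
            show ((2 : ℝ)) = ((2 : ℕ) : ℝ) by norm_num, Real.rpow_natCast]
        rw [e1, e2]
        field_simp

/-- **The fast set has a polynomial tail**: `vol({‖V y‖ ≥ a‖y‖} ∩ {‖y‖ ≥ R}) ≤ C″ R^{−1−2ρ}` for `R > 0` (`0 < ρ ≤ ½`; dyadic shells and the geometric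
tail of `BernoulliThinness.tsum_ofReal_mul_two_pow_mul_rpow_le`; any `ρ > 0`). [folklore] -/
theorem volume_fastSet_inter_far_le {ρ : ℝ} (hρ : 0 < ρ)
    {V : EuclideanSpace ℝ (Fin 3) → EuclideanSpace ℝ (Fin 3)} (hVm : AEStronglyMeasurable V volume) {c : ℝ≥0}
    (hA : ∀ L : ℝ, 0 < L → ∫⁻ y in ball (0 : EuclideanSpace ℝ (Fin 3)) L, ‖V y‖ₑ ^ 2 ≤
      c * ENNReal.ofReal (L ^ (1 - 2 * ρ)))
    {a : ℝ} (ha : 0 < a) :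
    ∃ C'' : ℝ, ∀ R : ℝ, 0 < R →
      volume ({y : EuclideanSpace ℝ (Fin 3) | a * ‖y‖ ≤ ‖V y‖} ∩ {y | R ≤ ‖y‖}) ≤ ENNReal.ofReal (C'' * R ^ (-1 - 2 * ρ)) := by
  -- adapted from `BernoulliThinness.volume_bernoulliHigh_inter_far_le`
  set C' : ℝ := (c : ℝ) * (3 : ℝ) ^ (1 - 2 * ρ) / a ^ 2 with hC'
  refine ⟨|C'| * (1 - (2 : ℝ) ^ (-1 - 2 * ρ))⁻¹, fun R hRpos => ?_⟩
  set Θ : Set (EuclideanSpace ℝ (Fin 3)) := {y | a * ‖y‖ ≤ ‖V y‖} with hΘ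
  set Sh : ℕ → Set (EuclideanSpace ℝ (Fin 3)) :=
    fun k => Θ ∩ {y | 2 ^ k * R ≤ ‖y‖ ∧ ‖y‖ ≤ 2 * (2 ^ k * R)} with hSh
  have hcover : Θ ∩ {y | R ≤ ‖y‖} ⊆ ⋃ k : ℕ, Sh k := by
    rintro y ⟨hy, hyR⟩
    have h1 : 1 ≤ ‖y‖ / R := by rw [le_div_iff₀ hRpos]; simpa using hyR
    obtain ⟨k, hk1, hk2⟩ := exists_nat_pow_near h1 one_lt_two
    refine mem_iUnion.mpr ⟨k, hy, ?_, ?_⟩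
    · have := (le_div_iff₀ hRpos).mp hk1
      linarith
    · have := (div_lt_iff₀ hRpos).mp hk2
      rw [pow_succ] at this
      linarith
  have hSk : ∀ k : ℕ, volume (Sh k) ≤ ENNReal.ofReal (C' * (2 ^ k * R) ^ (-1 - 2 * ρ)) := fun k =>
    volume_fastSet_inter_shell_le hVm hA ha (by positivity)
  calc volume (Θ ∩ {y | R ≤ ‖y‖}) ≤ volume (⋃ k : ℕ, Sh k) := measure_mono hcover
    _ ≤ ∑' k : ℕ, volume (Sh k) := measure_iUnion_le _
    _ ≤ ∑' k : ℕ, ENNReal.ofReal (C' * (2 ^ k * R) ^ (-1 - 2 * ρ)) := ENNReal.tsum_le_tsum hSk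
    _ ≤ ENNReal.ofReal (|C'| * (1 - (2 : ℝ) ^ (-1 - 2 * ρ))⁻¹ * R ^ (-1 - 2 * ρ)) :=
        tsum_ofReal_mul_two_pow_mul_rpow_le C' hRpos (by linarith)

/-! ### An unpressurised high set is fast -/

/-- **Far out, an unpressurised high Bernoulli set is a fast set.**  `0 < γ < ½`, `P(y) ≤ ε‖y‖²` for `‖y‖ ≥ R₁` with `ε ≤ γ(1−2γ)/4`: for every
level `h` there is `R₃` such that `ℋ(y) > h`, `‖y‖ ≥ R₃` imply `‖V y‖ ≥ a_γ‖y‖`, `a_γ = (√(γ/2) − γ)/2`. (`ℋ > h` and `P ≤ ε|y|²` give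
`|γy + V|² > (γ/2)|y|² + 2h`, while `|V| < a_γ|y|` gives `|γy + V| < (γ + a_γ)|y| < √(γ/2)|y|`.) [folklore] -/
theorem bernoulliHigh_subset_fastSet_of_pressure_le {γ : ℝ} (hγ : 0 < γ) (hγ2 : γ < 1 / 2)
    {V : EuclideanSpace ℝ (Fin 3) → EuclideanSpace ℝ (Fin 3)} {P : EuclideanSpace ℝ (Fin 3) → ℝ}
    {ε R₁ : ℝ} (hε : ε ≤ γ * (1 - 2 * γ) / 4) (hP : ∀ y : EuclideanSpace ℝ (Fin 3), R₁ ≤ ‖y‖ → P y ≤ ε * ‖y‖ ^ 2)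
    (h : ℝ) : ∃ R₃ : ℝ, ∀ y : EuclideanSpace ℝ (Fin 3), R₃ ≤ ‖y‖ → h < selfSimilarBernoulli γ 0 V P y →
      (Real.sqrt (γ / 2) - γ) / 2 * ‖y‖ ≤ ‖V y‖ := by
  set a : ℝ := (Real.sqrt (γ / 2) - γ) / 2 with hadef
  have hsq : γ < Real.sqrt (γ / 2) := by
    rw [Real.lt_sqrt hγ.le]; nlinarith
  have ha : 0 < a := by rw [hadef]; linarith
  have hsqrt2 : Real.sqrt (γ / 2) ^ 2 = γ / 2 := Real.sq_sqrt (by positivity)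
  -- the gap `d = γ/2 − (γ + a)² > 0`
  set d : ℝ := γ / 2 - (γ + a) ^ 2 with hddef
  have hga : γ + a < Real.sqrt (γ / 2) := by rw [hadef]; linarith
  have hd : 0 < d := by
    rw [hddef, ← hsqrt2]
    have : 0 ≤ γ + a := by linarith
    nlinarith
  refine ⟨max R₁ (max 1 (2 * |h| / d + 1)), fun y hy hH => ?_⟩
  have hyR₁ : R₁ ≤ ‖y‖ := (le_max_left _ _).trans hy
  have hy1 : 1 ≤ ‖y‖ := ((le_max_left _ _).trans (le_max_right _ _)).trans hy
  have hyh : 2 * |h| / d + 1 ≤ ‖y‖ := ((le_max_right _ _).trans (le_max_right _ _)).trans hy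
  have hyh' : 2 * |h| ≤ d * ‖y‖ ^ 2 := by
    have h1 : 2 * |h| / d ≤ ‖y‖ := by linarith
    rw [div_le_iff₀ hd] at h1
    have h2 : d * ‖y‖ * 1 ≤ d * ‖y‖ * ‖y‖ := mul_le_mul_of_nonneg_left hy1 (mul_nonneg hd.le (norm_nonneg y))
    nlinarith [h2]
  by_contra hlt
  push Not at hlt
  -- `|γy + V| < (γ + a)|y|`
  have hW : ‖γ • y + V y‖ < (γ + a) * ‖y‖ := by
    calc ‖γ • y + V y‖ ≤ ‖γ • y‖ + ‖V y‖ := norm_add_le _ _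
      _ < γ * ‖y‖ + a * ‖y‖ := by rw [norm_smul, Real.norm_of_nonneg hγ.le]; linarith
      _ = (γ + a) * ‖y‖ := by ring
  have hW2 : ‖γ • y + V y‖ ^ 2 < (γ + a) ^ 2 * ‖y‖ ^ 2 := by
    rw [← mul_pow]; exact pow_lt_pow_left₀ hW (norm_nonneg _) two_ne_zero
  -- `ℋ > h` with `P ≤ ε|y|²`
  have hHb : h < (1 / 2 : ℝ) * ‖γ • y + V y‖ ^ 2 + P y + γ * (γ - 1) / 2 * ‖y‖ ^ 2 := by
    have := hH; simp only [selfSimilarBernoulli_apply, sub_zero] at this; exact this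
  have hPy := hP y hyR₁
  have hε' : ε * ‖y‖ ^ 2 ≤ γ * (1 - 2 * γ) / 4 * ‖y‖ ^ 2 := mul_le_mul_of_nonneg_right hε (sq_nonneg _)
  -- combine: `(γ/2)|y|² + 2h < |γy+V|² < (γ+a)²|y|²`, i.e. `d|y|² < −2h ≤ 2|h|` — contradiction with `2|h| ≤ d|y|²`
  have key : d * ‖y‖ ^ 2 < -2 * h := by
    rw [hddef]; nlinarith
  linarith [neg_abs_le h, abs_nonneg h]

/-! ### Member level -/

/-- **EXACTLY SELF-SIMILAR MEMBERS WHOSE `C²` PROFILE OF LINEAR GROWTH HAS AN UNPRESSURISED FAR FIELD AND A SUPER-FAST FAR CHANNEL ARE TRIVIAL**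
(crux hypotheses verbatim, `0 < ρ ≤ ½`; `γ = 1/(2+ρ)`).  Hypotheses on the profile: `V ∈ C²`, `‖V y‖ ≤ K₁(1+‖y‖)`; for EVERY classical pressure
`P′` of `V` (CIV (3.3)): `P′(y) ≤ ε‖y‖²` for `‖y‖ ≥ R₁` with `ε ≤ γ(1−2γ)/4`, and on the far part of every high set `{ℋ_{P′} > h}` the channel bound
`⟪y, γy + V y⟫ ≤ −c₁‖y‖²`, with `c₁ > 3/((2+ρ)(1+2ρ))`.  Then `u = 0` a.e. on `(−∞,0) × ℝ³`.  (Thinness `m = 1+2ρ` of the high sets from the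
`A`-gauge via the fast set; the squeeze `Loc.curl_eq_zero_of_fastChannel_of_thin`; then the irrotational `C²` stratum.) [folklore] -/
theorem selfSimilar_ae_eq_zero_of_fastChannelC2_profile {ρ : ℝ} (hρ : 0 < ρ) (hρ1 : ρ ≤ 1 / 2)
    {u : ℝ → EuclideanSpace ℝ (Fin 3) → EuclideanSpace ℝ (Fin 3)} {p : ℝ → EuclideanSpace ℝ (Fin 3) → ℝ}
    {H : ℝ → EuclideanSpace ℝ (Fin 3) → EuclideanSpace ℝ (Fin 3) →L[ℝ] EuclideanSpace ℝ (Fin 3)} {c : ℝ≥0}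
    (hsw : IsSuitableWeakSolutionOn (slab (EuclideanSpace ℝ (Fin 3)) (Iio 0) isOpen_Iio) 0 0 u p)
    (hgauge : ∀ a : ℝ, 0 < a →
      ENNReal.ofReal (a ^ (2 * ρ)) * cknA a (0 : ℝ × EuclideanSpace ℝ (Fin 3)) u +
          ENNReal.ofReal (a ^ ρ) * cknE a (0 : ℝ × EuclideanSpace ℝ (Fin 3)) H +
        ENNReal.ofReal (a ^ (2 * ρ)) * cknD a (0 : ℝ × EuclideanSpace ℝ (Fin 3)) p ≤ (c : ℝ≥0∞))
    {V : EuclideanSpace ℝ (Fin 3) → EuclideanSpace ℝ (Fin 3)} {P : EuclideanSpace ℝ (Fin 3) → ℝ}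
    (hu : ∀ τ : ℝ, τ < 0 → u τ = selfSimilarCollapse (1 / (2 + ρ)) 0 V τ)
    (hp : ∀ τ : ℝ, τ < 0 → p τ = selfSimilarCollapsePressure (1 / (2 + ρ)) 0 P τ)
    (hV : ContDiff ℝ 2 V) {K₁ : ℝ} (hK₁ : ∀ y : EuclideanSpace ℝ (Fin 3), ‖V y‖ ≤ K₁ * (1 + ‖y‖))
    {c₁ : ℝ} (hc₁ : 3 / ((2 + ρ) * (1 + 2 * ρ)) < c₁)
    (hB : ∀ P' : EuclideanSpace ℝ (Fin 3) → ℝ, IsSelfSimilarEulerProfile (1 / (2 + ρ)) 0 V P' →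
      (∃ ε R₁ : ℝ, ε ≤ (1 / (2 + ρ)) * (1 - 2 * (1 / (2 + ρ))) / 4 ∧
        ∀ y : EuclideanSpace ℝ (Fin 3), R₁ ≤ ‖y‖ → P' y ≤ ε * ‖y‖ ^ 2) ∧
      (∀ h : ℝ, ∃ R₀ : ℝ, ∀ y : EuclideanSpace ℝ (Fin 3), R₀ ≤ ‖y‖ →
        h < selfSimilarBernoulli (1 / (2 + ρ)) 0 V P' y →
          ⟪y, selfSimilarTransport (1 / (2 + ρ)) 0 V y⟫ ≤ -(c₁ * ‖y‖ ^ 2))) :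
    uncurry u =ᵐ[volume.restrict (Iio (0 : ℝ) ×ˢ (univ : Set (EuclideanSpace ℝ (Fin 3))))] 0 := by
  -- adapted from `selfSimilar_ae_eq_zero_of_boundedBernoulliC2_profile` (…SelfSimilarBernoulliBounded)
  have hρ1' : ρ < 1 := by linarith
  have h2ρ : (0 : ℝ) < 2 + ρ := by linarith
  have hγ : (0 : ℝ) < 1 / (2 + ρ) := one_div_pos.2 h2ρ
  have hγ2 : 1 / (2 + ρ) < 1 / 2 := one_div_lt_one_div_of_lt two_pos (by linarith)
  have hA : ∀ a : ℝ, 0 < a → ENNReal.ofReal (a ^ (2 * ρ)) *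
      cknA a (0 : ℝ × EuclideanSpace ℝ (Fin 3)) u ≤ (c : ℝ≥0∞) :=
    fun a ha => le_trans (le_trans le_self_add le_self_add) (hgauge a ha)
  have hD : ∀ a : ℝ, 0 < a → ENNReal.ofReal (a ^ (2 * ρ)) *
      cknD a (0 : ℝ × EuclideanSpace ℝ (Fin 3)) p ≤ (c : ℝ≥0∞) :=
    fun a ha => le_trans le_add_self (hgauge a ha)
  have hum : AEStronglyMeasurable (uncurry u)
      (volume.restrict (Iio (0 : ℝ) ×ˢ (univ : Set (EuclideanSpace ℝ (Fin 3))))) := by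
    have := hsw.distributional.1.aestronglyMeasurable
    simpa [slab] using this
  have hpm : AEStronglyMeasurable (uncurry p)
      (volume.restrict (Iio (0 : ℝ) ×ˢ (univ : Set (EuclideanSpace ℝ (Fin 3))))) := by
    have := hsw.distributional.2.2.1.aestronglyMeasurable
    simpa [slab] using this
  have hVm : AEStronglyMeasurable V volume := aestronglyMeasurable_profile hum hu
  have hPm := aestronglyMeasurable_pressureProfile hpm hp
  have hDprof := profile_pressure_weight_of_gaugeD hρ hρ1' hpm hp hD
  have hP1 : LocallyIntegrable P volume :=
    EnergySaturation.locallyIntegrable_pressure_of_weight hρ1' hPm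
      (ENNReal.mul_ne_top ENNReal.ofReal_ne_top ENNReal.coe_ne_top) hDprof
  have hAprof := profile_energy_growth_of_gaugeA hρ hu hA
  obtain ⟨P', hprof⟩ := WeakToClassical.exists_isSelfSimilarEulerProfile_of_contDiff hsw.distributional hu hp hV hP1
  obtain ⟨⟨ε, R₁, hε, hPε⟩, hfast⟩ := hB P' hprof
  -- thinness of the high sets of `ℋ_{P'}` with rate `1 + 2ρ`, from the `A`-gauge via the fast set
  set a : ℝ := (Real.sqrt ((1 / (2 + ρ)) / 2) - 1 / (2 + ρ)) / 2 with hadef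
  have hsq : 1 / (2 + ρ) < Real.sqrt ((1 / (2 + ρ)) / 2) := by
    rw [Real.lt_sqrt hγ.le]; nlinarith
  have ha : 0 < a := by rw [hadef]; linarith
  obtain ⟨C'', hfar⟩ := volume_fastSet_inter_far_le hρ hVm hAprof ha
  have hthin : ∀ h : ℝ, ∃ C R₂ : ℝ, 0 < R₂ ∧ ∀ R : ℝ, R₂ ≤ R →
      volume ({y : EuclideanSpace ℝ (Fin 3) | h < selfSimilarBernoulli (1 / (2 + ρ)) 0 V P' y} ∩ {y | R ≤ ‖y‖}) ≤
        ENNReal.ofReal (C * R ^ (-(1 + 2 * ρ))) := by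
    intro h
    obtain ⟨R₃, hR₃⟩ := bernoulliHigh_subset_fastSet_of_pressure_le hγ hγ2 hε hPε h
    refine ⟨C'', max R₃ 1, by positivity, fun R hR => ?_⟩
    have hRpos : 0 < R := lt_of_lt_of_le (lt_of_lt_of_le one_pos (le_max_right _ _)) hR
    have hsub : {y : EuclideanSpace ℝ (Fin 3) | h < selfSimilarBernoulli (1 / (2 + ρ)) 0 V P' y} ∩ {y | R ≤ ‖y‖} ⊆
        {y : EuclideanSpace ℝ (Fin 3) | a * ‖y‖ ≤ ‖V y‖} ∩ {y | R ≤ ‖y‖} := by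
      rintro y ⟨hy, hyR⟩
      exact ⟨hR₃ y (((le_max_left _ _).trans hR).trans hyR) hy, hyR⟩
    refine (measure_mono hsub).trans ?_
    rw [show -(1 + 2 * ρ) = -1 - 2 * ρ by ring]
    exact hfar R hRpos
  -- the race `3γ < c₁ (1 + 2ρ)`
  have hrace : 3 * (1 / (2 + ρ)) < c₁ * (1 + 2 * ρ) := by
    have h12 : (0 : ℝ) < 1 + 2 * ρ := by linarith
    have h1 := (div_lt_iff₀ (by positivity : (0 : ℝ) < (2 + ρ) * (1 + 2 * ρ))).1 hc₁
    rw [show 3 * (1 / (2 + ρ)) = 3 / (2 + ρ) by ring, div_lt_iff₀ h2ρ]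
    nlinarith
  have hc₁0 : 0 < c₁ := lt_trans (by positivity) hc₁
  have hcurl : ∀ x, curl V x = 0 := fun x =>
    curl_eq_zero_of_fastChannel_of_thin hprof hγ hγ2 hK₁ hc₁0 hrace hthin hfast x
  exact Loc.selfSimilar_ae_eq_zero_of_irrotationalC2_profile hρ hsw.distributional hA hu hV hcurl

end Summit.NavierStokesRegularity.NavierStokesRegularity.Theorems.PowerGaugeEulerLiouville.Loc

end
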